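import Summits.AtomisticToContinuum.Crystallization.Theses.ChessboardParticlePlanes
import Literature.MathematicalPhysics.StatisticalMechanics.PeriodicConfigurationSums

/-!
# Crux `ChessboardParticlePlanes.LjPlaneChessboard` (stmt-AtomisticToContinuum-6709), line `Sketch`,
# stub `stub_planarPeriods` — two independent horizontal periods

If the heights `g 2` of the periods `g ∈ G` of a periodic configuration `Q` of `ℝ³` lie in a
cyclic group `c₀ℤ`, then the lattice of periods `G` contains two `ℝ`-linearly independent
HORIZONTAL vectors (so the horizontal sub-lattice `G ∩ {x₂ = 0}`, on which the period-2 restack of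
the crux is built, has rank 2).  [folklore]

PROOF.  `G` is free of rank 3 (`PeriodicConfiguration.finrank_lattice`); a `ℤ`-basis `b₀ b₁ b₂`
of `G` is an `ℝ`-basis of `ℝ³` (`Module.Basis.ofZLatticeBasis`).  Write `bᵢ 2 = c₀ nᵢ` with
`nᵢ ∈ ℤ`.  Not all `nᵢ` vanish: otherwise the height functional `x ↦ x 2` would vanish on a basis
of `ℝ³`, hence everywhere, which is false at `e₂`.  Re-index so that `n₀ ≠ 0`; then
`a := n₁ b₀ − n₀ b₁` and `b := n₂ b₀ − n₀ b₂` are horizontal periods, and a vanishing combination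
`s a + t b = (s n₁ + t n₂) b₀ − s n₀ b₁ − t n₀ b₂ = 0` forces `s n₀ = t n₀ = 0`, i.e. `s = t = 0`.
-/

noncomputable section

namespace Summit.AtomisticToContinuum.Crystallization.Theorems.ChessboardParticlePlanesLjPlaneChessboard

open Literature.MathematicalPhysics.StatisticalMechanics

/-- Linear algebra: if `f 0, f 1, f 2` are `ℝ`-linearly independent and `p ≠ 0`, then
`q • f 0 - p • f 1` and `r • f 0 - p • f 2` are linearly independent. [folklore] -/
theorem planarPeriods_linearIndependent_pair {E : Type*} [AddCommGroup E] [Module ℝ E]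
    {f : Fin 3 → E} (h : LinearIndependent ℝ f) {p : ℝ} (hp : p ≠ 0) (q r : ℝ) :
    LinearIndependent ℝ ![q • f 0 - p • f 1, r • f 0 - p • f 2] := by
  rw [LinearIndependent.pair_iff]
  intro s t hst
  have hsum : ∑ i, ![s * q + t * r, -(s * p), -(t * p)] i • f i = 0 := by
    rw [Fin.sum_univ_three]
    show (s * q + t * r) • f 0 + (-(s * p)) • f 1 + (-(t * p)) • f 2 = 0
    have : (s * q + t * r) • f 0 + (-(s * p)) • f 1 + (-(t * p)) • f 2 =
        s • (q • f 0 - p • f 1) + t • (r • f 0 - p • f 2) := by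
      module
    rw [this, hst]
  have h3 := Fintype.linearIndependent_iff.1 h _ hsum
  have hs : -(s * p) = 0 := h3 1
  have ht : -(t * p) = 0 := h3 2
  exact ⟨(mul_eq_zero.1 (neg_eq_zero.1 hs)).resolve_right hp,
    (mul_eq_zero.1 (neg_eq_zero.1 ht)).resolve_right hp⟩

/-- If the heights of the periods lie in `c₀ℤ`, there is a `ℤ`-basis of the lattice of periods,
indexed by `Fin 3`, whose heights are `c₀ nᵢ` with `n₀ ≠ 0` (a `ℤ`-basis of a full-rank lattice
spans `ℝ³`, so not all its vectors are horizontal; re-index). [folklore] -/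
theorem planarPeriods_exists_basis (Q : PeriodicConfiguration 3) (c₀ : ℝ)
    (hmul : ∀ g ∈ Q.lattice, ∃ k : ℤ, g 2 = c₀ * k) :
    ∃ (β : Module.Basis (Fin 3) ℤ Q.lattice) (n : Fin 3 → ℤ),
      (∀ i, (β i : EuclideanSpace ℝ (Fin 3)) 2 = c₀ * n i) ∧ n 0 ≠ 0 := by
  classical
  let β₀ : Module.Basis (Fin 3) ℤ Q.lattice :=
    Module.finBasisOfFinrankEq ℤ Q.lattice Q.finrank_lattice
  have hex : ∀ i : Fin 3, ∃ k : ℤ, (β₀ i : EuclideanSpace ℝ (Fin 3)) 2 = c₀ * k :=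
    fun i => hmul _ (β₀ i).2
  choose n₀ hn₀ using hex
  obtain ⟨i, hi⟩ : ∃ i, n₀ i ≠ 0 := by
    by_contra! h0
    -- every basis vector is horizontal, so the height functional vanishes on `ℝ³`
    have hφ : ((EuclideanSpace.proj (2 : Fin 3) : EuclideanSpace ℝ (Fin 3) →L[ℝ] ℝ) :
        EuclideanSpace ℝ (Fin 3) →ₗ[ℝ] ℝ) = 0 := by
      refine (β₀.ofZLatticeBasis ℝ Q.lattice).ext fun j => ?_
      change (β₀.ofZLatticeBasis ℝ Q.lattice j) 2 = 0
      rw [Module.Basis.ofZLatticeBasis_apply, hn₀ j, h0 j, Int.cast_zero, mul_zero]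
    have h1 := LinearMap.congr_fun hφ (EuclideanSpace.single (2 : Fin 3) (1 : ℝ))
    change (EuclideanSpace.single (2 : Fin 3) (1 : ℝ)) 2 = 0 at h1
    simp at h1
  refine ⟨β₀.reindex (Equiv.swap 0 i), n₀ ∘ Equiv.swap 0 i, fun l => ?_, ?_⟩
  · rw [Module.Basis.reindex_apply, Equiv.symm_swap]
    exact hn₀ _
  · show n₀ (Equiv.swap 0 i 0) ≠ 0
    rwa [Equiv.swap_apply_left]

/-- Given a `ℤ`-basis `β` of the lattice of periods with heights `(β i) 2 = c₀ nᵢ` and `n₀ ≠ 0`,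
the vectors `n₁ β₀ − n₀ β₁` and `n₂ β₀ − n₀ β₂` are two `ℝ`-linearly independent horizontal
periods. [folklore] -/
theorem planarPeriods_of_basis (Q : PeriodicConfiguration 3) {c₀ : ℝ} {n : Fin 3 → ℤ}
    (β : Module.Basis (Fin 3) ℤ Q.lattice)
    (hn : ∀ i, (β i : EuclideanSpace ℝ (Fin 3)) 2 = c₀ * n i) (h0 : n 0 ≠ 0) :
    ∃ a ∈ Q.lattice, ∃ b ∈ Q.lattice, a 2 = 0 ∧ b 2 = 0 ∧ LinearIndependent ℝ ![a, b] := by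
  -- the basis vectors are `ℝ`-linearly independent (a `ℤ`-basis of a lattice is an `ℝ`-basis)
  have hf : LinearIndependent ℝ (fun i => (β i : EuclideanSpace ℝ (Fin 3))) := by
    have hB := (β.ofZLatticeBasis ℝ Q.lattice).linearIndependent
    have : ⇑(β.ofZLatticeBasis ℝ Q.lattice) = fun i => (β i : EuclideanSpace ℝ (Fin 3)) :=
      funext fun i => β.ofZLatticeBasis_apply ℝ Q.lattice i
    rwa [this] at hB
  -- integer combinations of periods are periods
  have hmem : ∀ (p q : ℤ) (i j : Fin 3),
      (p : ℝ) • (β i : EuclideanSpace ℝ (Fin 3)) - (q : ℝ) • (β j : EuclideanSpace ℝ (Fin 3))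
        ∈ Q.lattice := by
    intro p q i j
    rw [Int.cast_smul_eq_zsmul ℝ, Int.cast_smul_eq_zsmul ℝ]
    exact Q.lattice.sub_mem (zsmul_mem (β i).2 p) (zsmul_mem (β j).2 q)
  -- the two combinations are horizontal
  have hht : ∀ i j : Fin 3,
      ((n j : ℝ) • (β i : EuclideanSpace ℝ (Fin 3)) - (n i : ℝ) • (β j : EuclideanSpace ℝ (Fin 3)))
        2 = 0 := by
    intro i j
    rw [PiLp.sub_apply, PiLp.smul_apply, PiLp.smul_apply, hn i, hn j, smul_eq_mul, smul_eq_mul]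
    ring
  exact ⟨_, hmem (n 1) (n 0) 0 1, _, hmem (n 2) (n 0) 0 2, hht 0 1, hht 0 2,
    planarPeriods_linearIndependent_pair hf (Int.cast_ne_zero.2 h0) _ _⟩

/-- **Stub 2 — planar periods.**  If the heights of the periods of a periodic configuration of
`ℝ³` lie in a cyclic group `c₀ℤ`, then the lattice of periods contains two `ℝ`-linearly
independent horizontal vectors.  Proof: take a `ℤ`-basis `b₀ b₁ b₂` of `G` (`finrank = 3`),
`bᵢ 2 = c₀ nᵢ` with `nᵢ ∈ ℤ` not all zero (the basis spans `ℝ³`); if say `n₀ ≠ 0` then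
`n₁b₀ − n₀b₁` and `n₂b₀ − n₀b₂` are horizontal periods, independent over `ℝ` because `b₀ b₁ b₂`
are (`ZLattice` bases are `ℝ`-bases). [folklore] -/
theorem stub_planarPeriods :
    ∀ Q : PeriodicConfiguration 3,
      (∃ c₀ : ℝ, 0 < c₀ ∧ (∃ g ∈ Q.lattice, g 2 = c₀) ∧ ∀ g ∈ Q.lattice, ∃ k : ℤ, g 2 = c₀ * k) →
      ∃ a ∈ Q.lattice, ∃ b ∈ Q.lattice, a 2 = 0 ∧ b 2 = 0 ∧ LinearIndependent ℝ ![a, b] := by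
  rintro Q ⟨c₀, -, -, hmul⟩
  obtain ⟨β, n, hn, h0⟩ := planarPeriods_exists_basis Q c₀ hmul
  exact planarPeriods_of_basis Q β hn h0

end Summit.AtomisticToContinuum.Crystallization.Theorems.ChessboardParticlePlanesLjPlaneChessboard
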